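import Mathlib.GroupTheory.PresentedGroup
import Mathlib.GroupTheory.Schreier
import Mathlib.GroupTheory.Commutator.Basic
import Mathlib.GroupTheory.Index
import Mathlib.GroupTheory.QuotientGroup.Basic
import Mathlib.Algebra.Group.Subgroup.Pointwise
import Mathlib.Data.ZMod.Basic
import Literature.GroupTheory.CombinatorialGroupTheory.SchreierIndexFormula
import HarnessLib

/-!
# One-relator groups on `≥ 4` generators act faithfully on the mod-`ℓ` homology of their
# finite-index normal subgroups

Topic `Literature/GroupTheory/CombinatorialGroupTheory`; theorems only (no definitions of record).

Let `Γ = ⟨α ∣ r⟩ = F(α)/⟨⟨r⟩⟩` be a ONE-relator group on a finite generating set `α` with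
`|α| ≥ 4` (the relator `r` is arbitrary, e.g. trivial: free groups of rank `≥ 4`, or the surface
relator `∏ [aᵢ, bᵢ]`: closed orientable surface groups of genus `g ≥ 2`), let `Γ₁ ⊴ Γ` be a normal
subgroup of finite index and `ℓ` a prime.  The finite group `Γ/Γ₁` acts by conjugation on the
elementary abelian `ℓ`-group `H₁(Γ₁; 𝔽_ℓ) = Γ₁ / ⁅Γ₁,Γ₁⁆Γ₁^ℓ`.  **Theorem**
(`PresentedGroup.mem_of_conj_mul_inv_mem_commutatorPow`): this action is FAITHFUL — if `γ ∈ Γ`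
acts trivially, i.e. `γ x γ⁻¹ x⁻¹ ∈ ⁅Γ₁,Γ₁⁆·⟨⟨y^ℓ : y ∈ Γ₁⟩⟩` for every `x ∈ Γ₁`, then `γ ∈ Γ₁`.

This is the group-theoretic core of the slimness of pro-`Σ` completions of closed surface groups
([AbsAnab] Lemma 1.3.1 proper case; [SemiAnbd] Example 2.10 "verticially slim"; [MT] Prop. 1.4),
in a form that never identifies the isomorphism type of `Γ₁` (no Riemann–Hurwitz / finite-index
subgroup structure of surface groups is used).

## Proof (index count; Lyndon–Schupp I.3.9 Schreier index formula is the only non-trivial input)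

Lift to `F = F(α)`, `d = |α|`: `F₁ = π⁻¹Γ₁` has index `n`, `F₂ = ⟨F₁, γ̃⟩` has index `k` with
`n = m k`, `m = [F₂ : F₁] ≥ 2` if `γ ∉ Γ₁`.  Put `L = ⁅F₁,F₁⁆·⟨⟨x^ℓ⟩⟩ ⊴ F` and
`K = π⁻¹(⁅Γ₁,Γ₁⁆·⟨⟨y^ℓ⟩⟩) = L · ⟨⟨r⟩⟩`.  By the Schreier index formula
(`FreeGroup.exists_freeGroupBasis_of_finiteIndex`) `F₁`, `F₂` are free of ranks
`ρ₁ = n(d-1)+1`, `ρ₂ = k(d-1)+1`; mapping a free basis of `F₁` onto the standard basis of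
`𝔽_ℓ^{ρ₁}` gives `ℓ^{ρ₁} ∣ [F₁ : L]`; the image of `⟨⟨r⟩⟩` in the abelian group `F₁/L` is generated
by the `n` classes of the transversal conjugates `t r t⁻¹`, so `[K : L] ≤ ℓ^n`.  The hypothesis
makes `E = F₂/K` ABELIAN with `F₁/K ⊆ E[ℓ]`, and `|E[ℓ]| = |E/E^ℓ| ≤ ℓ^{ρ₂}` (`E` is
`ρ₂`-generated; `card_dvd_exponent_pow_rank'`).  Hence `ρ₁ ≤ n + ρ₂`, i.e.
`(m-1)(d-2) ≤ 1`, forcing `m = 1` when `d ≥ 4`.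

## References

* R. C. Lyndon, P. E. Schupp, *Combinatorial Group Theory*, Springer (2001 reprint), Ch. I
  Prop. 3.9 (Schreier index formula). [LyndonSchupp2001]
* S. Mochizuki, *The absolute anabelian geometry of hyperbolic curves* (2004), Lemma 1.3.1 p. 15
  (slimness of geometric fundamental groups; the consumer of this file). [MochizukiAbsAnab2004]
-/

namespace Literature.GroupTheory.CombinatorialGroupTheory

open Subgroup
open scoped commutatorElement IsMulCommutative

universe u

/-! ### Counting lemmas -/

/-- **Counting lemma.**  A finitely generated commutative group of exponent dividing `ℓ ≠ 0` and of
rank `≤ ρ` is finite of order `≤ ℓ ^ ρ` (Mathlib's `card_dvd_exponent_pow_rank'`).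
[cite: LyndonSchupp2001, Ch. I Prop. 3.9] -/
theorem natCard_le_pow_of_forall_pow_eq_one {Q : Type*} [CommGroup Q] [Group.FG Q] {ℓ : ℕ}
    (hℓ : ℓ ≠ 0) (hQ : ∀ g : Q, g ^ ℓ = 1) {ρ : ℕ} (hρ : Group.rank Q ≤ ρ) :
    Nat.card Q ≠ 0 ∧ Nat.card Q ≤ ℓ ^ ρ := by
  have h := card_dvd_exponent_pow_rank' Q hQ
  have hne : ℓ ^ Group.rank Q ≠ 0 := pow_ne_zero _ hℓ
  refine ⟨fun h0 => hne (zero_dvd_iff.mp (h0 ▸ h)), ?_⟩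
  exact (Nat.le_of_dvd (Nat.pos_of_ne_zero hne) h).trans
    (Nat.pow_le_pow_right (Nat.pos_of_ne_zero hℓ) hρ)

/-- The normal closure of a conjugation-invariant set is its subgroup closure. [folklore] -/
private theorem normalClosure_eq_closure_of_conj_mem {G : Type*} [Group G] {s : Set G}
    (h : ∀ g : G, ∀ x ∈ s, g * x * g⁻¹ ∈ s) : normalClosure s = closure s := by
  apply le_antisymm
  · change closure (Group.conjugatesOfSet s) ≤ closure s
    refine closure_mono ?_
    intro x hx
    obtain ⟨a, ha, hc⟩ := Group.mem_conjugatesOfSet_iff.mp hx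
    obtain ⟨c, rfl⟩ := isConj_iff.mp hc
    exact h c a ha
  · exact closure_le_normalClosure

/-- The set of `ℓ`-th powers of a normal subgroup is conjugation-invariant. [folklore] -/
private theorem conj_mem_image_pow {G : Type*} [Group G] (H : Subgroup G) [hH : H.Normal] (ℓ : ℕ)
    (g x : G) (hx : x ∈ (fun y : G => y ^ ℓ) '' (H : Set G)) :
    g * x * g⁻¹ ∈ (fun y : G => y ^ ℓ) '' (H : Set G) := by
  obtain ⟨y, hy, rfl⟩ := hx
  exact ⟨g * y * g⁻¹, hH.conj_mem y hy g, by dsimp only; exact conj_pow⟩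

/-- For a normal subgroup `H`, `⟨⟨y ^ ℓ : y ∈ H⟩⟩ = ⟨y ^ ℓ : y ∈ H⟩`. [folklore] -/
private theorem normalClosure_image_pow_eq_closure {G : Type*} [Group G] (H : Subgroup G) [H.Normal]
    (ℓ : ℕ) : normalClosure ((fun y : G => y ^ ℓ) '' (H : Set G)) =
      closure ((fun y : G => y ^ ℓ) '' (H : Set G)) :=
  normalClosure_eq_closure_of_conj_mem (conj_mem_image_pow H ℓ)

/-! ### The mod-`ℓ` abelianization of a free group of finite rank -/

/-- A group with a free basis indexed by a finite type `ι` has a normal subgroup of index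
`ℓ ^ |ι|` containing all commutators and all `ℓ`-th powers (the kernel of the map onto
`𝔽_ℓ^ι` sending the basis to the standard basis). [cite: LyndonSchupp2001, Ch. I Prop. 3.9] -/
theorem exists_normal_index_eq_pow_of_freeGroupBasis {P : Type*} [Group P] {ι : Type*} [Finite ι]
    (b : FreeGroupBasis ι P) {ℓ : ℕ} (hℓ : ℓ ≠ 0) :
    ∃ N : Subgroup P, N.Normal ∧ N.index = ℓ ^ Nat.card ι ∧
      (∀ x y : P, x * y * x⁻¹ * y⁻¹ ∈ N) ∧ ∀ x : P, x ^ ℓ ∈ N := by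
  classical
  haveI : Fintype ι := Fintype.ofFinite ι
  haveI : NeZero ℓ := ⟨hℓ⟩
  let V : Type _ := ι → Multiplicative (ZMod ℓ)
  -- every element of `V` is killed by `ℓ`
  have hV : ∀ v : V, v ^ ℓ = 1 := by
    intro v
    funext i
    change (v i) ^ ℓ = 1
    rw [← ofAdd_toAdd (v i), ← ofAdd_nsmul, nsmul_eq_mul, ZMod.natCast_self, zero_mul,
      ofAdd_zero]
  let ψ : P →* V := b.lift fun i => Pi.mulSingle i (Multiplicative.ofAdd 1)
  have hψb : ∀ i, ψ (b i) = Pi.mulSingle i (Multiplicative.ofAdd 1) := by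
    intro i
    change FreeGroup.lift (fun i => Pi.mulSingle i (Multiplicative.ofAdd (1 : ZMod ℓ)))
      (b.repr (b i)) = _
    rw [b.repr_apply_coe, FreeGroup.lift_apply_of]
  -- `ψ` is surjective: the `mulSingle i 1` generate `V`
  have hsurj : Function.Surjective ψ := by
    rw [← MonoidHom.range_eq_top, eq_top_iff]
    intro v _
    rw [← Finset.univ_prod_mulSingle v]
    refine Subgroup.prod_mem _ fun i _ => ?_
    refine ⟨(b i) ^ (Multiplicative.toAdd (v i)).val, ?_⟩
    rw [map_pow, hψb, ← Pi.mulSingle_pow]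
    congr 1
    rw [← ofAdd_nsmul, nsmul_eq_mul, mul_one, ZMod.natCast_zmod_val, ofAdd_toAdd]
  refine ⟨ψ.ker, inferInstance, ?_, ?_, ?_⟩
  · -- index = card of the target
    rw [Subgroup.index_ker, MonoidHom.range_eq_top.mpr hsurj, Subgroup.card_top]
    change Nat.card (ι → Multiplicative (ZMod ℓ)) = _
    rw [Nat.card_fun, Nat.card_eq_fintype_card (α := Multiplicative (ZMod ℓ)),
      Fintype.card_multiplicative, ZMod.card, Nat.card_eq_fintype_card]
  · intro x y
    rw [MonoidHom.mem_ker, ← commutatorElement_def, map_commutatorElement,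
      commutatorElement_eq_one_iff_commute]
    exact Commute.all _ _
  · intro x
    rw [MonoidHom.mem_ker, map_pow]
    exact hV _

/-! ### Images in an `F₁`-abelianized quotient -/

section Transversal

variable {F : Type*} [Group F] (F₁ : Subgroup F) [hF₁ : F₁.Normal] (M : Subgroup F) [M.Normal]

omit hF₁ in
/-- If `⁅F₁, F₁⁆ ≤ M` then the image of `F₁` in `F ⧸ M` is commutative. [folklore] -/
private theorem isMulCommutative_map_mk' (hcomm : ∀ x ∈ F₁, ∀ y ∈ F₁, x * y * x⁻¹ * y⁻¹ ∈ M) :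
    IsMulCommutative (F₁.map (QuotientGroup.mk' M)) := by
  refine isMulCommutative_iff.mpr fun a b => Subtype.ext ?_
  obtain ⟨x, hx, hxa⟩ := a.2
  obtain ⟨y, hy, hyb⟩ := b.2
  change (a : F ⧸ M) * b = b * a
  rw [← hxa, ← hyb, ← map_mul, ← map_mul, QuotientGroup.mk'_apply, QuotientGroup.mk'_apply,
    QuotientGroup.eq]
  -- `(x y)⁻¹ (y x) ∈ M` since `x y x⁻¹ y⁻¹ ∈ M` and `M` is normal
  have h := hcomm x hx y hy
  have : (x * y)⁻¹ * (y * x) = (x * y)⁻¹ * (x * y * x⁻¹ * y⁻¹)⁻¹ * (x * y) := by group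
  rw [this]
  exact ‹M.Normal›.conj_mem' _ (M.inv_mem h) _

/-- **Transversal conjugates generate the image of a normal closure.**  Let `F₁ ⊴ F` be of finite
index, `M ⊴ F` with `⁅F₁,F₁⁆ ≤ M` and `x ^ ℓ ∈ M` for `x ∈ F₁` (`ℓ ≠ 0`), and `r ∈ F₁`.  Then the
image of `⟨⟨r⟩⟩` in `F ⧸ M` is a finite group of order at most `ℓ ^ [F : F₁]`: it is generated by
the classes of the `[F : F₁]` conjugates `t r t⁻¹` of `r` by a transversal, which lie in the
commutative exponent-`ℓ` group `F₁ M / M` (the Reidemeister–Schreier relators of `F₁`).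
[cite: LyndonSchupp2001, Ch. II Prop. 4.1] -/
theorem natCard_map_normalClosure_le [F₁.FiniteIndex] {ℓ : ℕ} (hℓ : ℓ ≠ 0)
    (hcomm : ∀ x ∈ F₁, ∀ y ∈ F₁, x * y * x⁻¹ * y⁻¹ ∈ M) (hpow : ∀ x ∈ F₁, x ^ ℓ ∈ M)
    {r : F} (hr : r ∈ F₁) :
    Nat.card ((normalClosure ({r} : Set F)).map (QuotientGroup.mk' M)) ≠ 0 ∧
      Nat.card ((normalClosure ({r} : Set F)).map (QuotientGroup.mk' M)) ≤ ℓ ^ F₁.index := by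
  classical
  haveI : Fintype (F ⧸ F₁) := Fintype.ofFinite _
  set π := QuotientGroup.mk' M with hπ
  let A : Subgroup (F ⧸ M) := F₁.map π
  haveI hA : IsMulCommutative A := isMulCommutative_map_mk' F₁ M hcomm
  have hApow : ∀ a ∈ A, a ^ ℓ = 1 := by
    rintro _ ⟨x, hx, rfl⟩
    rw [← map_pow, hπ, QuotientGroup.mk'_apply, QuotientGroup.eq_one_iff]
    exact hpow x hx
  have hAcomm : ∀ a ∈ A, ∀ b ∈ A, a * b = b * a := fun a ha b hb =>
    congr_arg Subtype.val (mul_comm (⟨a, ha⟩ : A) ⟨b, hb⟩)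
  -- the transversal and the set of transversal conjugates
  let T : Finset F := Finset.univ.image fun q : F ⧸ F₁ => q.out
  let S : Finset (F ⧸ M) := T.image fun t => π (t * r * t⁻¹)
  have hSA : (S : Set (F ⧸ M)) ⊆ A := by
    intro y hy
    obtain ⟨t, -, rfl⟩ := Finset.mem_image.mp (Finset.mem_coe.mp hy)
    exact ⟨t * r * t⁻¹, hF₁.conj_mem r hr t, rfl⟩
  have hScard : S.card ≤ F₁.index := by
    refine (Finset.card_image_le).trans ((Finset.card_image_le).trans ?_)
    rw [Finset.card_univ, index_eq_card, Nat.card_eq_fintype_card]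
  -- the image of the normal closure lies in the closure of `S`
  have hle : (normalClosure ({r} : Set F)).map π ≤ closure (S : Set (F ⧸ M)) := by
    change (closure (Group.conjugatesOfSet {r})).map π ≤ _
    rw [MonoidHom.map_closure]
    refine (closure_le _).mpr ?_
    rintro _ ⟨x, hx, rfl⟩
    obtain ⟨a, ha, hc⟩ := Group.mem_conjugatesOfSet_iff.mp hx
    rw [Set.mem_singleton_iff] at ha
    subst ha
    obtain ⟨g, rfl⟩ := isConj_iff.mp hc
    -- write `g = t h⁻¹` with `t` the chosen representative of `g F₁`
    obtain ⟨h, hth⟩ := QuotientGroup.mk_out_eq_mul F₁ g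
    set t : F := (QuotientGroup.mk g : F ⧸ F₁).out with htdef
    have htT : t ∈ T := Finset.mem_image.mpr ⟨QuotientGroup.mk g, Finset.mem_univ _, rfl⟩
    have hg : g = t * (h : F)⁻¹ := by rw [hth, mul_inv_cancel_right]
    -- `u = t h⁻¹ t⁻¹ ∈ F₁` conjugates `t r t⁻¹` to `g r g⁻¹`
    have hu : t * (h : F)⁻¹ * t⁻¹ ∈ F₁ := hF₁.conj_mem _ (F₁.inv_mem h.2) t
    have htr : t * a * t⁻¹ ∈ F₁ := hF₁.conj_mem a hr t
    have hconj : g * a * g⁻¹ = (t * (h : F)⁻¹ * t⁻¹) * (t * a * t⁻¹) * (t * (h : F)⁻¹ * t⁻¹)⁻¹ := by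
      rw [hg]; group
    rw [hconj, map_mul, map_mul, map_inv,
      hAcomm _ ⟨_, hu, rfl⟩ _ ⟨_, htr, rfl⟩, mul_inv_cancel_right]
    exact subset_closure (Finset.mem_coe.mpr (Finset.mem_image.mpr ⟨t, htT, rfl⟩))
  -- the closure of `S` is a finite commutative group of exponent `ℓ` on `≤ [F : F₁]` generators
  have hCS : closure (S : Set (F ⧸ M)) ≤ A := (closure_le _).mpr hSA
  haveI : IsMulCommutative (closure (S : Set (F ⧸ M))) :=
    isMulCommutative_closure fun x hx y hy => hAcomm x (hSA hx) y (hSA hy)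
  have hbound := natCard_le_pow_of_forall_pow_eq_one (Q := closure (S : Set (F ⧸ M))) hℓ
    (fun g => Subtype.ext (by simpa using hApow g.1 (hCS g.2)))
    ((Subgroup.rank_closure_finset_le_card S).trans hScard)
  haveI : Finite (closure (S : Set (F ⧸ M))) := Nat.finite_of_card_ne_zero hbound.1
  have hcard := Subgroup.card_le_of_le hle
  refine ⟨?_, hcard.trans hbound.2⟩
  haveI : Finite ((normalClosure ({r} : Set F)).map π) :=
    Finite.of_injective _ (Subgroup.inclusion_injective hle)
  exact Nat.card_pos.ne'

end Transversal

/-! ### The abelian upper bound -/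

/-- **The `ℓ`-torsion of a finite `ρ`-generated commutative group has order `≤ ℓ ^ ρ`.**  Let `E` be a
finite subgroup of a group `Q` with pairwise commuting elements and `Group.rank E ≤ ρ`, and `A ≤ E`
a subgroup all of whose elements are killed by `ℓ ≠ 0`.  Then `|A| ≤ ℓ ^ ρ`
(`|E[ℓ]| = |E / E^ℓ|` and `E/E^ℓ` is `ρ`-generated of exponent `ℓ`). [folklore] -/
private theorem natCard_le_pow_of_le_of_isMulCommutative {Q : Type*} [Group Q] (A E : Subgroup Q)
    [IsMulCommutative E] [Finite E] [Group.FG E] (hAE : A ≤ E) {ℓ : ℕ} (hℓ : ℓ ≠ 0)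
    (hA : ∀ a ∈ A, a ^ ℓ = 1) {ρ : ℕ} (hρ : Group.rank E ≤ ρ) : Nat.card A ≤ ℓ ^ ρ := by
  classical
  let f : E →* E := powMonoidHom ℓ
  -- `A ≤ ker f`
  have hAker : A.subgroupOf E ≤ f.ker := by
    intro a ha
    rw [MonoidHom.mem_ker]
    change a ^ ℓ = 1
    exact Subtype.ext (by simpa using hA a.1 ha)
  have h1 : Nat.card A = Nat.card (A.subgroupOf E) :=
    (Nat.card_congr (subgroupOfEquivOfLe hAE).toEquiv).symm
  have h2 : Nat.card (A.subgroupOf E) ≤ Nat.card f.ker := Subgroup.card_le_of_le hAker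
  -- `|ker f| = |E ⧸ range f|`
  have h3 : Nat.card f.ker = Nat.card (E ⧸ f.range) := by
    have hk := Subgroup.card_eq_card_quotient_mul_card_subgroup f.ker
    have hr := Subgroup.card_eq_card_quotient_mul_card_subgroup f.range
    rw [Nat.card_congr (QuotientGroup.quotientKerEquivRange f).toEquiv] at hk
    have hpos : 0 < Nat.card f.range := Nat.card_pos
    rw [hk, mul_comm] at hr
    exact Nat.eq_of_mul_eq_mul_right hpos hr
  -- `E ⧸ range f` is commutative of exponent `ℓ` and rank `≤ ρ`
  haveI : Group.FG (E ⧸ f.range) := Group.fg_of_surjective (QuotientGroup.mk'_surjective _)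
  have h4 := natCard_le_pow_of_forall_pow_eq_one (Q := E ⧸ f.range) hℓ
    (by
      intro q
      obtain ⟨e, rfl⟩ := QuotientGroup.mk_surjective q
      rw [← QuotientGroup.mk_pow, QuotientGroup.eq_one_iff]
      exact ⟨e, rfl⟩)
    ((Group.rank_le_of_surjective (QuotientGroup.mk' f.range) (QuotientGroup.mk'_surjective _)).trans
      hρ)
  calc Nat.card A = Nat.card (A.subgroupOf E) := h1
    _ ≤ Nat.card f.ker := h2
    _ = Nat.card (E ⧸ f.range) := h3
    _ ≤ ℓ ^ ρ := h4.2


/-- Classes of `x, y` commute in `G ⧸ M` when `x y x⁻¹ y⁻¹ ∈ M`. [folklore] -/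
private theorem QuotientGroup.mk'_mul_comm_of_mem {G : Type*} [Group G] (M : Subgroup G) [M.Normal]
    {x y : G} (h : x * y * x⁻¹ * y⁻¹ ∈ M) :
    QuotientGroup.mk' M x * QuotientGroup.mk' M y = QuotientGroup.mk' M y * QuotientGroup.mk' M x := by
  rw [← map_mul, ← map_mul, QuotientGroup.mk'_apply, QuotientGroup.mk'_apply, QuotientGroup.eq]
  have : (x * y)⁻¹ * (y * x) = (x * y)⁻¹ * (x * y * x⁻¹ * y⁻¹)⁻¹ * (x * y) := by group
  rw [this]
  exact ‹M.Normal›.conj_mem' _ (M.inv_mem h) _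

/-- A free group basis generates. [folklore] -/
private theorem FreeGroupBasis.closure_range_eq_top {ι P : Type*} [Group P] (b : FreeGroupBasis ι P) :
    closure (Set.range b) = ⊤ := by
  rw [eq_top_iff]
  intro x _
  have hx : b.repr x ∈ closure (Set.range (FreeGroup.of : ι → FreeGroup ι)) := by
    rw [FreeGroup.closure_range_of]; exact mem_top _
  have := Subgroup.mem_map_of_mem (b.repr.symm : FreeGroup ι →* P) hx
  rw [MonoidHom.map_closure, ← Set.range_comp] at this
  have hrange : ((b.repr.symm : FreeGroup ι →* P) ∘ FreeGroup.of) = ⇑b := rfl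
  rw [hrange] at this
  simpa using this

/-! ### The theorem -/

/-- **One-relator groups on `≥ 4` generators act faithfully on the mod-`ℓ` homology of their
finite-index normal subgroups.**  Let `Γ = ⟨α ∣ r⟩` with `α` finite, `|α| ≥ 4`, `r` arbitrary;
`Γ₁ ⊴ Γ` of finite index; `ℓ` prime; `γ ∈ Γ`.  If `γ x γ⁻¹ x⁻¹ ∈ ⁅Γ₁, Γ₁⁆ · ⟨⟨y ^ ℓ : y ∈ Γ₁⟩⟩` for
every `x ∈ Γ₁` (conjugation by `γ` is trivial on `H₁(Γ₁; 𝔽_ℓ)`), then `γ ∈ Γ₁`.  (For closed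
surface groups `Γ = S_g`, `g ≥ 2`: the engine of [AbsAnab] Lemma 1.3.1, proper case — slimness of
pro-`Σ` surface groups — with no appeal to the structure of finite-index subgroups of `S_g`.)
[cite: MochizukiAbsAnab2004, Lemma 1.3.1 p.15] -/
theorem PresentedGroup.mem_of_conj_mul_inv_mem_commutatorPow {α : Type u} [Finite α]
    (hα : 4 ≤ Nat.card α) (r : FreeGroup α)
    (Γ₁ : Subgroup (PresentedGroup ({r} : Set (FreeGroup α)))) [hΓn : Γ₁.Normal]
    [hΓi : Γ₁.FiniteIndex] {ℓ : ℕ} (hℓ : ℓ.Prime) (γ : PresentedGroup ({r} : Set (FreeGroup α)))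
    (hγ : ∀ x ∈ Γ₁, γ * x * γ⁻¹ * x⁻¹ ∈
      ⁅Γ₁, Γ₁⁆ ⊔ normalClosure ((fun y => y ^ ℓ) ''
        (Γ₁ : Set (PresentedGroup ({r} : Set (FreeGroup α)))))) :
    γ ∈ Γ₁ := by
  classical
  have hℓ0 : ℓ ≠ 0 := hℓ.ne_zero
  -- the presentation `π : F = F(α) → Γ`
  let π : FreeGroup α →* PresentedGroup ({r} : Set (FreeGroup α)) := PresentedGroup.mk _
  have hπs : Function.Surjective π := PresentedGroup.mk_surjective _
  have hπker : π.ker = normalClosure ({r} : Set (FreeGroup α)) := by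
    ext x; exact PresentedGroup.mk_eq_one_iff
  by_contra hγ₁
  obtain ⟨γ', rfl⟩ := hπs γ
  -- `F₁ = π⁻¹ Γ₁`
  set F₁ : Subgroup (FreeGroup α) := Γ₁.comap π with hF₁def
  haveI hF₁n : F₁.Normal := hΓn.comap π
  have hF₁i : F₁.index = Γ₁.index := Γ₁.index_comap_of_surjective hπs
  haveI hF₁fi : F₁.FiniteIndex := ⟨by rw [hF₁i]; exact hΓi.index_ne_zero⟩
  have hγ'F₁ : γ' ∉ F₁ := hγ₁
  have hmapF₁ : F₁.map π = Γ₁ := Subgroup.map_comap_eq_self_of_surjective hπs _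
  have hrF₁ : r ∈ F₁ := by
    change π r ∈ Γ₁
    have : π r = 1 := PresentedGroup.mk_eq_one_iff.mpr (subset_normalClosure rfl)
    rw [this]; exact one_mem _
  -- `K = π⁻¹ (⁅Γ₁,Γ₁⁆ ⟨⟨y^ℓ⟩⟩)`, `L = ⁅F₁,F₁⁆ ⟨⟨x^ℓ⟩⟩`
  set MΓ : Subgroup (PresentedGroup ({r} : Set (FreeGroup α))) :=
    ⁅Γ₁, Γ₁⁆ ⊔ normalClosure ((fun y => y ^ ℓ) ''
      (Γ₁ : Set (PresentedGroup ({r} : Set (FreeGroup α))))) with hMΓdef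
  have hMΓle : MΓ ≤ Γ₁ := sup_le (Subgroup.commutator_le_left Γ₁ Γ₁)
    (normalClosure_le_normal (by rintro _ ⟨y, hy, rfl⟩; exact Γ₁.pow_mem hy ℓ))
  set K : Subgroup (FreeGroup α) := MΓ.comap π with hKdef
  set L : Subgroup (FreeGroup α) :=
    ⁅F₁, F₁⁆ ⊔ normalClosure ((fun y => y ^ ℓ) '' (F₁ : Set (FreeGroup α))) with hLdef
  have hKF₁ : K ≤ F₁ := Subgroup.comap_mono hMΓle
  have hcommL : ∀ x ∈ F₁, ∀ y ∈ F₁, x * y * x⁻¹ * y⁻¹ ∈ L := fun x hx y hy =>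
    mem_sup_left (by simpa [commutatorElement_def] using commutator_mem_commutator hx hy)
  have hpowL : ∀ x ∈ F₁, x ^ ℓ ∈ L := fun x hx =>
    mem_sup_right (subset_normalClosure ⟨x, hx, rfl⟩)
  have hLK : L ≤ K := by
    refine sup_le ?_ (normalClosure_le_normal ?_)
    · rw [commutator_le]
      intro x hx y hy
      change π ⁅x, y⁆ ∈ MΓ
      rw [map_commutatorElement]
      exact mem_sup_left (commutator_mem_commutator hx hy)
    · rintro _ ⟨x, hx, rfl⟩
      change π (x ^ ℓ) ∈ MΓ
      rw [map_pow]
      exact mem_sup_right (subset_normalClosure ⟨π x, hx, rfl⟩)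
  have hcommK : ∀ x ∈ F₁, ∀ y ∈ F₁, x * y * x⁻¹ * y⁻¹ ∈ K := fun x hx y hy =>
    hLK (hcommL x hx y hy)
  have hpowK : ∀ x ∈ F₁, x ^ ℓ ∈ K := fun x hx => hLK (hpowL x hx)
  have hγK : ∀ x ∈ F₁, γ' * x * γ'⁻¹ * x⁻¹ ∈ K := by
    intro x hx
    change π (γ' * x * γ'⁻¹ * x⁻¹) ∈ MΓ
    simpa only [map_mul, map_inv] using hγ (π x) hx
  have hKLR : K ≤ L ⊔ normalClosure ({r} : Set (FreeGroup α)) := by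
    haveI : (L.map π).Normal := Subgroup.Normal.map inferInstance π hπs
    have hM : MΓ ≤ L.map π := by
      refine sup_le ?_ (normalClosure_le_normal ?_)
      · rw [← hmapF₁, ← map_commutator]
        exact map_mono le_sup_left
      · rintro _ ⟨y, hy, rfl⟩
        rw [← hmapF₁] at hy
        obtain ⟨x, hx, rfl⟩ := hy
        exact ⟨x ^ ℓ, hpowL x hx, map_pow π x ℓ⟩
    calc K ≤ (L.map π).comap π := Subgroup.comap_mono hM
      _ = L ⊔ π.ker := Subgroup.comap_map_eq π L
      _ = L ⊔ normalClosure ({r} : Set (FreeGroup α)) := by rw [hπker]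
  -- `F₂ = ⟨F₁, γ'⟩`
  set F₂ : Subgroup (FreeGroup α) := closure ((F₁ : Set (FreeGroup α)) ∪ {γ'}) with hF₂def
  have hF₁F₂ : F₁ ≤ F₂ := fun x hx => subset_closure (Or.inl hx)
  have hγ'F₂ : γ' ∈ F₂ := subset_closure (Or.inr rfl)
  haveI hF₂fi : F₂.FiniteIndex := Subgroup.finiteIndex_of_le hF₁F₂
  -- Schreier bases
  obtain ⟨ι₁, b₁, hι₁, hρ₁⟩ := FreeGroup.exists_freeGroupBasis_of_finiteIndex F₁
  obtain ⟨ι₂, b₂, hι₂, hρ₂⟩ := FreeGroup.exists_freeGroupBasis_of_finiteIndex F₂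
  haveI := Fintype.ofFinite ι₂
  -- indices: `[F : F₁] = m [F : F₂]`, `m ≥ 2`
  have hnmk : F₁.relIndex F₂ * F₂.index = F₁.index := relIndex_mul_index hF₁F₂
  have hm1 : F₁.relIndex F₂ ≠ 1 := fun h => hγ'F₁ (relIndex_eq_one.mp h hγ'F₂)
  have hm0 : F₁.relIndex F₂ ≠ 0 := fun h => by
    rw [h, zero_mul] at hnmk; exact hF₁fi.index_ne_zero hnmk.symm
  have hk0 : F₂.index ≠ 0 := hF₂fi.index_ne_zero
  -- (a) `ℓ ^ ρ₁ ∣ [F₁ : L]`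
  obtain ⟨N₁, hN₁n, hN₁i, hN₁c, hN₁p⟩ := exists_normal_index_eq_pow_of_freeGroupBasis b₁ hℓ0
  have hLN₁ : L.subgroupOf F₁ ≤ N₁ := by
    have hle : L ≤ N₁.map F₁.subtype := by
      refine sup_le ?_ ?_
      · rw [commutator_le]
        intro x hx y hy
        exact ⟨⟨x, hx⟩ * ⟨y, hy⟩ * ⟨x, hx⟩⁻¹ * ⟨y, hy⟩⁻¹, hN₁c _ _,
          by simp [commutatorElement_def]⟩
      · rw [normalClosure_image_pow_eq_closure, closure_le]
        rintro _ ⟨x, hx, rfl⟩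
        exact ⟨⟨x, hx⟩ ^ ℓ, hN₁p _, by simp⟩
    have := Subgroup.comap_mono (f := F₁.subtype) hle
    rwa [Subgroup.comap_map_eq_self_of_injective F₁.subtype_injective] at this
  have hdvd : ℓ ^ Nat.card ι₁ ∣ L.relIndex F₁ := hN₁i ▸ index_dvd_of_le hLN₁
  -- (b) `[K : L] ≤ ℓ ^ [F : F₁]`, finite
  have hb : L.relIndex K ≠ 0 ∧ L.relIndex K ≤ ℓ ^ F₁.index := by
    obtain ⟨hR0, hRle⟩ := natCard_map_normalClosure_le F₁ L hℓ0 hcommL hpowL hrF₁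
    have hker : (QuotientGroup.mk' L).ker = L := QuotientGroup.ker_mk' L
    have hrel : L.relIndex K = Nat.card (K.map (QuotientGroup.mk' L)) := by
      rw [← Subgroup.relIndex_ker K (QuotientGroup.mk' L), hker]
    have hle : K.map (QuotientGroup.mk' L) ≤
        (normalClosure ({r} : Set (FreeGroup α))).map (QuotientGroup.mk' L) := by
      refine (map_mono hKLR).trans ?_
      rw [Subgroup.map_sup, (Subgroup.map_eq_bot_iff L).mpr (by rw [hker]), bot_sup_eq]
    haveI : Finite ((normalClosure ({r} : Set (FreeGroup α))).map (QuotientGroup.mk' L)) :=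
      Nat.finite_of_card_ne_zero hR0
    haveI : Finite (K.map (QuotientGroup.mk' L)) :=
      Finite.of_injective _ (Subgroup.inclusion_injective hle)
    rw [hrel]
    exact ⟨Nat.card_pos.ne', (Subgroup.card_le_of_le hle).trans hRle⟩
  -- (c) `[F₁ : K] ≤ ℓ ^ ρ₂`, finite
  have hc : K.relIndex F₁ ≠ 0 ∧ K.relIndex F₁ ≤ ℓ ^ Nat.card ι₂ := by
    set πK := QuotientGroup.mk' K with hπK
    have hker : πK.ker = K := QuotientGroup.ker_mk' K
    have hrel : K.relIndex F₁ = Nat.card (F₁.map πK) := by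
      rw [← Subgroup.relIndex_ker F₁ πK, hker]
    set A : Subgroup (FreeGroup α ⧸ K) := F₁.map πK with hAdef
    haveI hAc : IsMulCommutative A := isMulCommutative_map_mk' F₁ K hcommK
    have hApow : ∀ a ∈ A, a ^ ℓ = 1 := by
      rintro _ ⟨x, hx, rfl⟩
      rw [← map_pow, hπK, QuotientGroup.mk'_apply, QuotientGroup.eq_one_iff]
      exact hpowK x hx
    -- `A` is finite (commutative, exponent `ℓ`, finitely generated)
    haveI : Group.FG A := by
      rw [hAdef, ← MonoidHom.restrict_range]; infer_instance
    have hA0 := (natCard_le_pow_of_forall_pow_eq_one (Q := A) hℓ0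
      (fun g => Subtype.ext (by simpa using hApow g.1 g.2)) le_rfl).1
    haveI : Finite A := Nat.finite_of_card_ne_zero hA0
    -- `E = F₂ K / K` is commutative
    set E : Subgroup (FreeGroup α ⧸ K) := closure (πK '' ((F₁ : Set (FreeGroup α)) ∪ {γ'}))
      with hEdef
    have hEF₂ : F₂.map πK = E := by rw [hF₂def, MonoidHom.map_closure]
    have hAE : A ≤ E := by rw [← hEF₂]; exact map_mono hF₁F₂
    haveI hEc : IsMulCommutative E := by
      refine isMulCommutative_closure ?_
      rintro _ ⟨x, hx, rfl⟩ _ ⟨y, hy, rfl⟩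
      rcases hx with hx | hx <;> rcases hy with hy | hy
      · exact QuotientGroup.mk'_mul_comm_of_mem K (hcommK x hx y hy)
      · rw [Set.mem_singleton_iff] at hy; subst hy
        exact (QuotientGroup.mk'_mul_comm_of_mem K (hγK x hx)).symm
      · rw [Set.mem_singleton_iff] at hx; subst hx
        exact QuotientGroup.mk'_mul_comm_of_mem K (hγK y hy)
      · rw [Set.mem_singleton_iff] at hx hy; subst hx; subst hy; rfl
    -- `E` is finite: `K` has finite index in `F`
    haveI : K.FiniteIndex := ⟨by
      rw [← relIndex_mul_index hKF₁, hrel]; exact mul_ne_zero hA0 hF₁fi.index_ne_zero⟩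
    haveI : Finite E := inferInstance
    -- `E` is generated by the images of the `ρ₂` basis elements of `F₂`
    let S₂ : Finset (FreeGroup α ⧸ K) := Finset.univ.image fun i => πK (b₂ i : FreeGroup α)
    have hF₂gen : F₂ = closure (Set.range fun i => (b₂ i : FreeGroup α)) := by
      apply le_antisymm
      · intro x hx
        have h1 : (⟨x, hx⟩ : F₂) ∈ closure (Set.range b₂) := by
          rw [FreeGroupBasis.closure_range_eq_top]; trivial
        have h2 := Subgroup.mem_map_of_mem F₂.subtype h1
        rw [MonoidHom.map_closure, ← Set.range_comp] at h2
        exact h2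
      · rw [closure_le]; rintro _ ⟨i, rfl⟩; exact (b₂ i).2
    have hES₂ : E = closure (S₂ : Set (FreeGroup α ⧸ K)) := by
      rw [← hEF₂, hF₂gen, MonoidHom.map_closure, ← Set.range_comp]
      congr 1
      ext y
      simp only [S₂, Finset.coe_image, Finset.coe_univ, Set.image_univ, Set.mem_range,
        Function.comp_apply]
    haveI : Group.FG E := by rw [hES₂]; infer_instance
    have hErank : Group.rank E ≤ Nat.card ι₂ := by
      rw [Subgroup.rank_congr hES₂]
      refine (Subgroup.rank_closure_finset_le_card S₂).trans ?_
      exact Finset.card_image_le.trans (by rw [Finset.card_univ, Nat.card_eq_fintype_card])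
    refine ⟨by rwa [hrel], ?_⟩
    rw [hrel]
    exact natCard_le_pow_of_le_of_isMulCommutative A E hAE hℓ0 hApow hErank
  -- (d) numerics
  have hprod : L.relIndex K * K.relIndex F₁ = L.relIndex F₁ := relIndex_mul_relIndex L K F₁ hLK hKF₁
  have h1 : ℓ ^ Nat.card ι₁ ≤ ℓ ^ (F₁.index + Nat.card ι₂) := by
    have hne : L.relIndex F₁ ≠ 0 := by rw [← hprod]; exact mul_ne_zero hb.1 hc.1
    calc ℓ ^ Nat.card ι₁ ≤ L.relIndex F₁ := Nat.le_of_dvd (Nat.pos_of_ne_zero hne) hdvd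
      _ = L.relIndex K * K.relIndex F₁ := hprod.symm
      _ ≤ ℓ ^ F₁.index * ℓ ^ Nat.card ι₂ := Nat.mul_le_mul hb.2 hc.2
      _ = ℓ ^ (F₁.index + Nat.card ι₂) := (pow_add _ _ _).symm
  have h2 : Nat.card ι₁ ≤ F₁.index + Nat.card ι₂ :=
    (Nat.pow_le_pow_iff_right hℓ.one_lt).mp h1
  have hm2 : 2 ≤ F₁.relIndex F₂ := by omega
  have hk1 : 1 ≤ F₂.index := Nat.one_le_iff_ne_zero.mpr hk0
  -- `ρ₁ = n(d-1)+1`, `ρ₂ = k(d-1)+1`, `n = m k`, `m ≥ 2`, `d ≥ 4` ⇒ contradiction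
  have key : F₁.index * Nat.card α + F₂.index ≤ 2 * F₁.index + F₂.index * Nat.card α := by
    linarith
  have hn2k : 2 * F₂.index ≤ F₁.index := by
    rw [← hnmk]; exact Nat.mul_le_mul_right _ hm2
  nlinarith [hn2k, hk1, hα, key]


end Literature.GroupTheory.CombinatorialGroupTheory
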